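import Summits.BirchSwinnertonDyer.BirchSwinnertonDyer.Theorems.QuadraticBranchSignedControlPlusEtaNonsurjThetaFunctionalEquationNormCoordinateQuadratic
import HarnessLib

/-!
# Route `QuadraticBranchSignedControl` (rung K8, cell `bsd-potss`), residual crux `PlusEtaMainConjectureNonsurj`
# (stmt-BirchSwinnertonDyer-19606): THE FUNCTIONAL EQUATION ON THE QUADRATIC BRANCH, XLI — HIGHER DEGREE: **a root from the lowest vertex
# (`‖h₀‖ < ‖h₁‖²` ⟹ a `ℤ_p`-root, any degree)** and **the CUBIC slope test (`‖h₀‖ = p⁻²`, `‖h₁‖ ≤ p⁻²`, `‖h₂‖ ≤ p⁻¹` ⟹ no root ⟹ irreducible)**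
# for the `k = 3` rows of the census (seat `bsd-potss-k8eta-c2` g31; kernel, fact-free)

WHY. Parts XXXIV/XXXVII decide the quadratic norm polynomials; the census has two `k = 3` rows (cm27a4_157: `H ≡ Z³ + 10Z² (mod 25)`; cm36a2_449:
`H ≡ Z³ + 15Z² + 15Z (mod 25)`) and one `k = 4` row. Two tests cover what their next digits can show: (§120) for a monic `H` of ANY degree,
`‖H(0)‖ < ‖H′(0)‖²`, i.e. `‖h₀‖ < ‖h₁‖²` (`2v(h₁) < v(h₀)`), gives a root `z ∈ ℤ_p` with `‖z‖ < ‖h₁‖` (Hensel at `0`) — then `H = (Z − z)·H₁` with `H₁`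
distinguished of degree `k − 1` (Part XXXI `divByMonic_isDistinguishedAt_of_root`) and `H` is NOT irreducible (cm36a2_449 if level 6 shows
`v_5(h₀) ≥ 3`); (§121) for a monic CUBIC with `‖h₀‖ = p⁻²`, `‖h₁‖ ≤ p⁻²`, `‖h₂‖ ≤ p⁻¹` (Newton polygon one segment of slope `−2/3`) there is NO
root — a unit `z` makes `z³` the strictly largest term, a non-unit `z` makes `h₀` the strictly largest term — hence `H` is IRREDUCIBLE (a monic cubic
over a domain without roots) and the Kato reading is all-or-nothing (Part XXXIV §100): cm27a4_157 if level 6 shows `v_5(h₀) = 2`.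

WHAT (5 theorems). §120 **`exists_root_of_norm_coeff_zero_lt_sq`**, `not_irreducible_of_root`; §121 `eval_eq_of_natDegree_three`,
**`eval_ne_zero_of_cubic_slope`**, **`irreducible_of_cubic_slope`**.

HONEST FRAMING (cell `bsd-potss`; FULL-BSD rank ≤ 1 programme, HUMAN RULING D-0036/D-0074): TOOL THEOREMS ONLY — `p`-adic algebra of monic
polynomials; no definition, no named fact, no `sorry`, axioms standard; row names are census labels; nothing about (A), (C1⁺_η), C-cc-1 or `BSD(W,p)`
is claimed; no stub of 19606 is proved; crux and route OPEN; nothing booked. `--supports stmt-BirchSwinnertonDyer-19606`.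

References: K. Conrad, Hensel's lemma (Mathlib `hensels_lemma`); [Washington1997] §7.1; Newton polygons (Koblitz IV.3, guide only). Tree: Parts XXXI,
XXXIV, XXXVII.
-/

set_option autoImplicit false
set_option linter.dupNamespace false
noncomputable section

open scoped Classical Topology

open PowerSeries Literature.NumberTheory.EllipticCurves Literature.NumberTheory.EllipticCurves.IwasawaAlgebra

namespace Summit.BirchSwinnertonDyer.BirchSwinnertonDyer.Theorems.EtaThetaFunctionalEquation

variable {p : ℕ} [hp : Fact p.Prime]

/-! ## §120 A root from the lowest vertex (any degree) -/

/-- **A ROOT FROM THE LOWEST VERTEX.** For ANY polynomial `H ∈ ℤ_p[Z]` with `‖h₀‖ < ‖h₁‖²` (`2v(h₁) < v(h₀)`): there is `z ∈ ℤ_p` with `H(z) = 0`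
and `‖z‖ < ‖h₁‖` (Hensel's lemma at `a₀ = 0`: `H(0) = h₀`, `H′(0) = h₁`). [folklore] -/
theorem exists_root_of_norm_coeff_zero_lt_sq (H : Polynomial ℤ_[p]) (h : ‖H.coeff 0‖ < ‖H.coeff 1‖ ^ 2) :
    ∃ z : ℤ_[p], H.eval z = 0 ∧ ‖z‖ < ‖H.coeff 1‖ := by
  have e1 : H.eval 0 = H.coeff 0 := by rw [Polynomial.coeff_zero_eq_eval_zero]
  have e2 : H.derivative.eval 0 = H.coeff 1 := by
    rw [← Polynomial.coeff_zero_eq_eval_zero, Polynomial.coeff_derivative, zero_add, Nat.cast_zero, zero_add, mul_one]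
  have hn : ‖Polynomial.aeval (0 : ℤ_[p]) H‖ < ‖Polynomial.aeval (0 : ℤ_[p]) (Polynomial.derivative H)‖ ^ 2 := by
    rw [Polynomial.coe_aeval_eq_eval, e1, e2]; exact h
  obtain ⟨z, hz, hza, -, -⟩ := hensels_lemma hn
  rw [Polynomial.coe_aeval_eq_eval] at hz hza
  rw [sub_zero, e2] at hza
  exact ⟨z, hz, hza⟩

/-- A monic polynomial of degree `≥ 2` with a root is not irreducible (`H = (Z − z)·(H /ₘ (Z − z))`, both factors non-units). [folklore] -/
theorem not_irreducible_of_root {H : Polynomial ℤ_[p]} (hmon : H.Monic) (hd : 2 ≤ H.natDegree) {z : ℤ_[p]} (hz : H.eval z = 0) :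
    ¬ Irreducible H := by
  intro hirr
  have hfac : (Polynomial.X - Polynomial.C z) * (H /ₘ (Polynomial.X - Polynomial.C z)) = H :=
    Polynomial.mul_divByMonic_eq_iff_isRoot.mpr hz
  have hQmon : (H /ₘ (Polynomial.X - Polynomial.C z)).Monic :=
    (Polynomial.monic_X_sub_C z).of_mul_monic_left (by rw [hfac]; exact hmon)
  have hQdeg : (H /ₘ (Polynomial.X - Polynomial.C z)).natDegree = H.natDegree - 1 := by
    rw [Polynomial.natDegree_divByMonic _ (Polynomial.monic_X_sub_C z), Polynomial.natDegree_X_sub_C]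
  rcases hirr.isUnit_or_isUnit hfac.symm with hu | hu
  · have h1 := (Polynomial.monic_X_sub_C z).isUnit_iff.mp hu
    have h2 := congr_arg Polynomial.natDegree h1
    rw [Polynomial.natDegree_X_sub_C, Polynomial.natDegree_one] at h2
    exact one_ne_zero h2
  · have h1 := hQmon.isUnit_iff.mp hu
    have h2 := congr_arg Polynomial.natDegree h1
    rw [hQdeg, Polynomial.natDegree_one] at h2
    omega

/-! ## §121 The cubic slope test: `‖h₀‖ = p⁻²`, `‖h₁‖ ≤ p⁻²`, `‖h₂‖ ≤ p⁻¹` ⟹ irreducible -/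

/-- `H(x) = x³ + h₂x² + h₁x + h₀` for a monic cubic. [folklore] -/
theorem eval_eq_of_natDegree_three {H : Polynomial ℤ_[p]} (hmon : H.Monic) (h3 : H.natDegree = 3) (x : ℤ_[p]) :
    H.eval x = x ^ 3 + H.coeff 2 * x ^ 2 + H.coeff 1 * x + H.coeff 0 := by
  have htop : H.coeff 3 = 1 := by rw [← h3]; exact hmon.coeff_natDegree
  rw [Polynomial.eval_eq_sum_range' (n := 4) (by omega), Finset.sum_range_succ, Finset.sum_range_succ, Finset.sum_range_succ,
    Finset.sum_range_succ, Finset.sum_range_zero, htop]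
  ring

/-- **THE CUBIC SLOPE TEST ⟹ NO ROOT.** `H` monic of degree `3` with `‖h₀‖ = p⁻²`, `‖h₁‖ ≤ p⁻²`, `‖h₂‖ ≤ p⁻¹` has no root in `ℤ_p`: if `‖z‖ = 1` then
`z³` is the strictly largest of the four terms of `H(z)`; if `‖z‖ ≤ p⁻¹` then `h₀` is (`‖z³‖, ‖h₂z²‖, ‖h₁z‖ ≤ p⁻³ < p⁻²`). [folklore] -/
theorem eval_ne_zero_of_cubic_slope {H : Polynomial ℤ_[p]} (hmon : H.Monic) (h3 : H.natDegree = 3)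
    (h0 : ‖H.coeff 0‖ = ((p : ℝ)⁻¹) ^ 2) (h1 : ‖H.coeff 1‖ ≤ ((p : ℝ)⁻¹) ^ 2) (h2 : ‖H.coeff 2‖ ≤ (p : ℝ)⁻¹) (z : ℤ_[p]) :
    H.eval z ≠ 0 := by
  intro hz
  rw [eval_eq_of_natDegree_three hmon h3] at hz
  have hp1 : (1 : ℝ) < p := Nat.one_lt_cast.mpr hp.out.one_lt
  have hq0 : (0 : ℝ) < (p : ℝ)⁻¹ := by positivity
  have hq1 : (p : ℝ)⁻¹ < 1 := inv_lt_one_of_one_lt₀ hp1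
  rcases (PadicInt.norm_le_one z).lt_or_eq with hzlt | hz1
  · -- `‖z‖ ≤ p⁻¹`: `h₀` is the strictly largest term
    have hzle : ‖z‖ ≤ (p : ℝ)⁻¹ := by
      have := (PadicInt.norm_lt_one_iff_dvd z).mp hzlt
      obtain ⟨c, rfl⟩ := this
      rw [norm_mul, PadicInt.norm_p]
      exact mul_le_of_le_one_right hq0.le (PadicInt.norm_le_one c)
    have hz2 : ‖z‖ ^ 2 ≤ ((p : ℝ)⁻¹) ^ 2 := pow_le_pow_left₀ (norm_nonneg _) hzle 2
    have hz3 : ‖z‖ ^ 3 ≤ ((p : ℝ)⁻¹) ^ 3 := pow_le_pow_left₀ (norm_nonneg _) hzle 3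
    have hlt3 : ((p : ℝ)⁻¹) ^ 3 < ((p : ℝ)⁻¹) ^ 2 := pow_lt_pow_right_of_lt_one₀ hq0 hq1 (by norm_num)
    have hA : ‖z ^ 3‖ < ‖H.coeff 0‖ := by rw [norm_pow, h0]; exact hz3.trans_lt hlt3
    have hB : ‖H.coeff 2 * z ^ 2‖ < ‖H.coeff 0‖ := by
      rw [norm_mul, norm_pow, h0]
      calc ‖H.coeff 2‖ * ‖z‖ ^ 2 ≤ (p : ℝ)⁻¹ * ((p : ℝ)⁻¹) ^ 2 := mul_le_mul h2 hz2 (by positivity) hq0.le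
        _ = ((p : ℝ)⁻¹) ^ 3 := by ring
        _ < ((p : ℝ)⁻¹) ^ 2 := hlt3
    have hC : ‖H.coeff 1 * z‖ < ‖H.coeff 0‖ := by
      rw [norm_mul, h0]
      calc ‖H.coeff 1‖ * ‖z‖ ≤ ((p : ℝ)⁻¹) ^ 2 * (p : ℝ)⁻¹ := mul_le_mul h1 hzle (norm_nonneg _) (by positivity)
        _ = ((p : ℝ)⁻¹) ^ 3 := by ring
        _ < ((p : ℝ)⁻¹) ^ 2 := hlt3
    have hS : ‖z ^ 3 + H.coeff 2 * z ^ 2 + H.coeff 1 * z‖ < ‖H.coeff 0‖ :=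
      (PadicInt.nonarchimedean _ _).trans_lt (max_lt ((PadicInt.nonarchimedean _ _).trans_lt (max_lt hA hB)) hC)
    have hD : ‖(z ^ 3 + H.coeff 2 * z ^ 2 + H.coeff 1 * z) + H.coeff 0‖ = ‖H.coeff 0‖ := by
      rw [PadicInt.norm_add_eq_max_of_ne hS.ne, max_eq_right hS.le]
    rw [hz, norm_zero] at hD
    rw [← hD] at h0
    exact (pow_pos hq0 2).ne' h0.symm
  · -- `‖z‖ = 1`: `z³` is the strictly largest term
    have hA : ‖H.coeff 2 * z ^ 2‖ < 1 := by
      rw [norm_mul, norm_pow, hz1, one_pow, mul_one]; exact h2.trans_lt hq1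
    have hB : ‖H.coeff 1 * z‖ < 1 := by
      rw [norm_mul, hz1, mul_one]; exact h1.trans_lt (by nlinarith)
    have hC : ‖H.coeff 0‖ < 1 := by rw [h0]; nlinarith
    have hS : ‖H.coeff 2 * z ^ 2 + H.coeff 1 * z + H.coeff 0‖ < ‖z ^ 3‖ := by
      rw [norm_pow, hz1, one_pow]
      exact (PadicInt.nonarchimedean _ _).trans_lt (max_lt ((PadicInt.nonarchimedean _ _).trans_lt (max_lt hA hB)) hC)
    have hD : ‖z ^ 3 + (H.coeff 2 * z ^ 2 + H.coeff 1 * z + H.coeff 0)‖ = ‖z ^ 3‖ := by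
      rw [PadicInt.norm_add_eq_max_of_ne hS.ne', max_eq_left hS.le]
    rw [show z ^ 3 + (H.coeff 2 * z ^ 2 + H.coeff 1 * z + H.coeff 0) = z ^ 3 + H.coeff 2 * z ^ 2 + H.coeff 1 * z + H.coeff 0 by ring,
      hz, norm_zero, norm_pow, hz1, one_pow] at hD
    exact zero_ne_one hD

/-- **THE CUBIC SLOPE TEST ⟹ IRREDUCIBLE** (a monic cubic over a domain without roots is irreducible), hence the all-or-nothing Kato reading of Part
XXXIV §100 on such a `k = 3` row. [folklore] -/
theorem irreducible_of_cubic_slope {H : Polynomial ℤ_[p]} (hmon : H.Monic) (h3 : H.natDegree = 3)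
    (h0 : ‖H.coeff 0‖ = ((p : ℝ)⁻¹) ^ 2) (h1 : ‖H.coeff 1‖ ≤ ((p : ℝ)⁻¹) ^ 2) (h2 : ‖H.coeff 2‖ ≤ (p : ℝ)⁻¹) : Irreducible H :=
  (hmon.irreducible_iff_roots_eq_zero_of_degree_le_three (by omega) (by omega)).mpr
    (Multiset.eq_zero_of_forall_notMem fun z hz ↦
      eval_ne_zero_of_cubic_slope hmon h3 h0 h1 h2 z ((Polynomial.mem_roots hmon.ne_zero).mp hz))

end Summit.BirchSwinnertonDyer.BirchSwinnertonDyer.Theorems.EtaThetaFunctionalEquation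

end
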